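import Mathlib.Data.EReal.Basic
import Mathlib.Data.Setoid.Partition
import Literature.NumberTheory.Transcendental.SemialgebraicMaps
import HarnessLib

/-!
# Cylindrical decomposition adapted to finitely many semialgebraic sets
(Basu–Pollack–Roy 2006, Def. 5.1, Thm. 5.6, Cor. 5.7)

A *cylindrical decomposition* of `ℝᵏ` [BasuPollackRoy2006, Def. 5.1] is a sequence
`𝒮₁, …, 𝒮ₖ` of finite partitions of `ℝ¹, …, ℝᵏ` into semialgebraic *cells* such that the cells of
level `1` are points and open intervals and, for every level-`i` cell `S` (`i < k`), there are finitely
many continuous semialgebraic functions `ξ_{S,1} < ⋯ < ξ_{S,ℓ_S} : S → ℝ` for which the cylinder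
`S × ℝ` is the disjoint union of those cells of level `i + 1` that are the graphs of the `ξ_{S,j}`
and the bands `{(x', t) | x' ∈ S, ξ_{S,j}(x') < t < ξ_{S,j+1}(x')}`, `j = 0, …, ℓ_S`, with
`ξ_{S,0} = -∞`, `ξ_{S,ℓ_S+1} = +∞`. It is *adapted to* a finite family `T₁, …, T_ℓ ⊆ ℝᵏ` if every
`Tᵢ` is a union of cells [loc. cit., after Prop. 5.3]. **Theorem 5.6 / Corollary 5.7** [loc. cit.]:
every finite family of semialgebraic subsets of `ℝᵏ` admits an adapted cylindrical decomposition.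

## What is vendored

* `graphOver S f`, `bandOver S ξ j` (with `bandLower`/`bandUpper : EReal`-valued boundaries,
  `ξ_{S,0} = ⊥`, `ξ_{S,ℓ+1} = ⊤`) — the two kinds of cells of Def. 5.1 over a base set `S ⊆ ℝⁿ`, in
  the tree's `Fin.init`/`Fin.last`/`Fin.snoc` coordinates (last coordinate distinguished, as in
  `Literature.NumberTheory.Transcendental.IsSemialgebraicFunOn` and `KZ.newtonLeibnizRel`); sections
  are indexed from `0` (`ξ : Fin ℓ → _`, bands by `Fin (ℓ + 1)`).
* `IsCylinderStack k 𝒮 𝒯` — the inductive clause of Def. 5.1: `𝒯` consists exactly of the graphs and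
  bands of continuous `k`-semialgebraic `ξ_{S,0} < ⋯ < ξ_{S,ℓ_S-1}` over the cells `S ∈ 𝒮`.
* `IsCylindricalDecomposition k n 𝒮` — Def. 5.1, by recursion on the level: `𝒮` is the level-`n`
  partition of a cylindrical decomposition of `ℝⁿ` with `k`-semialgebraic cells and sections (level
  `0`: the one-point space `ℝ⁰` is its only cell, the convention of [BasuPollackRoy2006, Prop. 5.3]
  and [Dries1998, Ch. 3 (2.6)]; the lower levels are quantified existentially, cf. [Dries1998, Ch. 3
  (2.10)] "every decomposition of `R^{m+1}` arises in this way from a decomposition of `R^m`").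
* `IsSemialgebraic.exists_cylindricalDecomposition k` — **named fact** (not proved here):
  Cor. 5.7 for `k`-semialgebraic sets, i.e. semialgebraic sets *defined over* the subring
  `D = image of k` of `ℝ` [BasuPollackRoy2006, §2.3, p. 109 (PDF)]: the adapted decomposition has
  `k`-semialgebraic cells and `k`-semialgebraic continuous sections.
* `IsSemialgebraic.exists_cylindricalDecomposition.exists_fibre_eq` — PROVED corollary in the shape
  used by the Kontsevich–Zagier Stokes reduction (route GaussManinCertificates, crux `KZStokes`): for
  one `k`-semialgebraic `σ ⊆ ℝⁿ⁺¹`, base cells `S` partitioning `ℝⁿ` with sections `ξ_S`, and for each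
  `S` FIXED index sets `G`, `B` such that for every `x ∈ S` the vertical fibre `{t | (x, t) ∈ σ}` is
  `⋃_{j ∈ G} {ξ_{S,j}(x)} ∪ ⋃_{j ∈ B} (ξ_{S,j-1}(x), ξ_{S,j}(x))`.

## Why the coefficient ring may be restricted (faithfulness of the `k`-version)

[BasuPollackRoy2006] prove Thm. 5.6 constructively and uniformly in an ordered subring of
coefficients: the cells of the decomposition adapted to a finite `𝒫 ⊂ D[X₁, …, X_k]` are the
realizations of the sign conditions on the *cylindrifying family* obtained from `𝒫` by alternately
closing under `∂/∂Xᵢ` and applying `Elim_{Xᵢ}` [Thm. 5.34 with Lemma 5.33 (Thom's lemma),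
Not. 5.15, Thm. 5.16], and `Elim_{Xᵢ}` (signed subresultant coefficients, leading coefficients,
truncations) maps finite subsets of `D[X₁, …, Xᵢ]` to finite subsets of `D[X₁, …, X_{i-1}]`
[Algorithm 11.1/11.2, "Structure: an ordered integral domain `D` contained in a real closed field
`R`", output `Elim_{X_k}(𝒫) ⊂ D[X₁, …, X_{k-1}]`]. Hence all cells are `D`-semialgebraic, and so are
the sections `ξ_{S,j}`, whose graphs are cells of the next level (Def. 5.1); they are continuous by
Thm. 5.16. A `D`-semialgebraic set is `𝒫`-semialgebraic for a finite `𝒫 ⊂ D[X]` (Def. 5.5), and a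
decomposition adapted to `𝒫` is adapted to it (loc. cit.), which gives Cor. 5.7 over `D`. For our
`IsSemialgebraic k` (polynomials over `k` evaluated through `algebraMap k ℝ`) the relevant subring is
`D = Set.range (algebraMap k ℝ)`, and `k`-semialgebraic = `D`-semialgebraic (the coefficient map
`k → D` is surjective).

## What is NOT here

* No proof of the named fact: the printed proof needs continuity of the roots of a univariate
  polynomial in its coefficients and the gcd-degree/subresultant analysis [BasuPollackRoy2006,
  Thm. 5.12, Prop. 5.13–5.14, Prop. 4.24], semialgebraic connectedness of cells [Prop. 5.3] and
  Thom's lemma [Lemma 5.33]; of this the tree has only Tarski–Seidenberg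
  (`Literature.ModelTheory.ExponentialFields.tarski_seidenberg_real_holds`). Theory-sized; the cite
  item (wi-11017) asked for the statement only.
* Only the ambient field `ℝ` (as for `tarski_seidenberg_real`): the theorem holds over every real
  closed field `R` [BasuPollackRoy2006, Thm. 5.6], but Mathlib has no `IsRealClosed ℝ` instance at the
  pin, so the real case used downstream would not be a specialisation inside the tree; no consumer
  asked for general `R`.
* Not vendored: the `𝒫`-invariant form (Def. 5.5/Thm. 5.6 for a finite set of polynomials), the
  semialgebraic homeomorphism of cells with open cubes (Prop. 5.3), the induced decomposition above a
  point (p. 209), dimension (§5.3), stratifications (§5.5). [Dries1998, Ch. 3 (2.11)] is the same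
  theorem for o-minimal structures *with parameters*, hence is not the cite for the `ℚ`-version.

## References (read at the cited places, PDF pages of the held copies)

* [BasuPollackRoy2006] S. Basu, R. Pollack, M.-F. Roy, *Algorithms in Real Algebraic Geometry*,
  2nd ed. (2006): §2.3 p. 109 ("defined over `D`"), Thm. 2.76; Def. 5.1, Rem. 5.2, Prop. 5.3,
  Def. 5.5, Thm. 5.6, Cor. 5.7 (pp. 206–209); Prop. 5.14, Not. 5.15, Thm. 5.16, proof of Thm. 5.6
  (pp. 212–214); Lemma 5.33, Thm. 5.34, Rem. 5.35 (pp. 220–221); Algorithms 11.1, 11.2 (pp. 416–419).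
* [Dries1998] L. van den Dries, *Tame topology and o-minimal structures* (1998), Ch. 3 (2.6),
  (2.10), (2.11) (pp. 66–67).
* [BCR1998] J. Bochnak, M. Coste, M.-F. Roy, *Real Algebraic Geometry* (1998), §2.3 (cylindrical
  algebraic decomposition) — cited by the requesting route; not re-read here (not held).
-/

noncomputable section

open Set
open Literature.NumberTheory.Transcendental (IsSemialgebraicFunOn isSemialgebraicFunOn_iff)

namespace Literature.ModelTheory.ExponentialFields

variable {n l : ℕ}

/-! ### The two kinds of cells over a base set (Def. 5.1) -/

section Cells

/-- The *graph* over `S ⊆ ℝⁿ` of a function `f : ℝⁿ → ℝ`, as a subset of `ℝⁿ⁺¹` with the last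
coordinate distinguished: `{(x', t) | x' ∈ S, t = f x'}` (the first kind of cell of a cylindrical
decomposition above `S`). [cite: BasuPollackRoy2006, Def. 5.1] -/
def graphOver (S : Set (Fin n → ℝ)) (f : (Fin n → ℝ) → ℝ) : Set (Fin (n + 1) → ℝ) :=
  {z | Fin.init z ∈ S ∧ z (Fin.last n) = f (Fin.init z)}

/-- Lower boundary of the `j`-th band (`j = 0, …, ℓ`) cut out by sections `ξ₀ < ⋯ < ξ_{ℓ-1}`:
`ξ_{j-1}`, with the convention `ξ_{-1} = -∞` (BPR's `ξ_{S,0} = -∞`, sections indexed from `0` here).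
[cite: BasuPollackRoy2006, Def. 5.1] -/
def bandLower (ξ : Fin l → (Fin n → ℝ) → ℝ) (j : Fin (l + 1)) (x : Fin n → ℝ) : EReal :=
  Fin.cases (motive := fun _ => EReal) ⊥ (fun i => ((ξ i x : ℝ) : EReal)) j

/-- Upper boundary of the `j`-th band (`j = 0, …, ℓ`) cut out by sections `ξ₀ < ⋯ < ξ_{ℓ-1}`:
`ξ_j`, with the convention `ξ_ℓ = +∞` (BPR's `ξ_{S,ℓ_S+1} = +∞`).
[cite: BasuPollackRoy2006, Def. 5.1] -/
def bandUpper (ξ : Fin l → (Fin n → ℝ) → ℝ) (j : Fin (l + 1)) (x : Fin n → ℝ) : EReal :=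
  Fin.lastCases (motive := fun _ => EReal) ⊤ (fun i => ((ξ i x : ℝ) : EReal)) j

/-- The `j`-th *band* over `S ⊆ ℝⁿ` cut out by sections `ξ₀ < ⋯ < ξ_{ℓ-1} : ℝⁿ → ℝ`
(`j = 0, …, ℓ`): `{(x', t) | x' ∈ S, ξ_{j-1} x' < t < ξ_j x'}` with `ξ_{-1} = -∞`, `ξ_ℓ = +∞`
(the second kind of cell of a cylindrical decomposition above `S`; for `ℓ = 0` the single band is
the whole cylinder `S × ℝ`). [cite: BasuPollackRoy2006, Def. 5.1] -/
def bandOver (S : Set (Fin n → ℝ)) (ξ : Fin l → (Fin n → ℝ) → ℝ) (j : Fin (l + 1)) :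
    Set (Fin (n + 1) → ℝ) :=
  {z | Fin.init z ∈ S ∧ bandLower ξ j (Fin.init z) < (z (Fin.last n) : EReal) ∧
    (z (Fin.last n) : EReal) < bandUpper ξ j (Fin.init z)}

/-- The lowest band is unbounded below: `ξ_{-1} = -∞`. [cite: BasuPollackRoy2006, Def. 5.1] -/
@[simp] theorem bandLower_zero (ξ : Fin l → (Fin n → ℝ) → ℝ) (x : Fin n → ℝ) :
    bandLower ξ 0 x = ⊥ := rfl

/-- The band above the `i`-th section is bounded below by it. [cite: BasuPollackRoy2006, Def. 5.1] -/
@[simp] theorem bandLower_succ (ξ : Fin l → (Fin n → ℝ) → ℝ) (i : Fin l) (x : Fin n → ℝ) :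
    bandLower ξ i.succ x = ξ i x := by
  simp only [bandLower, Fin.cases_succ]

/-- The highest band is unbounded above: `ξ_ℓ = +∞`. [cite: BasuPollackRoy2006, Def. 5.1] -/
@[simp] theorem bandUpper_last (ξ : Fin l → (Fin n → ℝ) → ℝ) (x : Fin n → ℝ) :
    bandUpper ξ (Fin.last l) x = ⊤ := by
  simp only [bandUpper, Fin.lastCases_last]

/-- The band below the `i`-th section is bounded above by it. [cite: BasuPollackRoy2006, Def. 5.1] -/
@[simp] theorem bandUpper_castSucc (ξ : Fin l → (Fin n → ℝ) → ℝ) (i : Fin l) (x : Fin n → ℝ) :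
    bandUpper ξ i.castSucc x = ξ i x := by
  simp only [bandUpper, Fin.lastCases_castSucc]

/-- With at least one section, the lowest band is bounded above by `ξ₀`. [cite: BasuPollackRoy2006, Def. 5.1] -/
@[simp] theorem bandUpper_zero (ξ : Fin (l + 1) → (Fin n → ℝ) → ℝ) (x : Fin n → ℝ) :
    bandUpper ξ 0 x = ξ 0 x := by
  rw [← Fin.castSucc_zero, bandUpper_castSucc]

/-- With at least one section, the highest band is bounded below by the last section.
[cite: BasuPollackRoy2006, Def. 5.1] -/
@[simp] theorem bandLower_last (ξ : Fin (l + 1) → (Fin n → ℝ) → ℝ) (x : Fin n → ℝ) :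
    bandLower ξ (Fin.last (l + 1)) x = ξ (Fin.last l) x := by
  rw [← Fin.succ_last, bandLower_succ]

/-- The lower boundary of a band other than the lowest is the section just below it.
[cite: BasuPollackRoy2006, Def. 5.1] -/
theorem bandLower_of_ne_zero (ξ : Fin l → (Fin n → ℝ) → ℝ) (j : Fin (l + 1)) (hj : j ≠ 0)
    (x : Fin n → ℝ) : bandLower ξ j x = ξ (j.pred hj) x := by
  conv_lhs => rw [← Fin.succ_pred j hj]
  rw [bandLower_succ]

/-- The upper boundary of a band other than the highest is the section just above it.
[cite: BasuPollackRoy2006, Def. 5.1] -/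
theorem bandUpper_of_ne_last (ξ : Fin l → (Fin n → ℝ) → ℝ) (j : Fin (l + 1)) (hj : j ≠ Fin.last l)
    (x : Fin n → ℝ) : bandUpper ξ j x = ξ (j.castPred hj) x := by
  conv_lhs => rw [← Fin.castSucc_castPred j hj]
  rw [bandUpper_castSucc]

/-- Unfolding lemma for `graphOver`. [cite: BasuPollackRoy2006, Def. 5.1] -/
theorem mem_graphOver_iff {S : Set (Fin n → ℝ)} {f : (Fin n → ℝ) → ℝ} {z : Fin (n + 1) → ℝ} :
    z ∈ graphOver S f ↔ Fin.init z ∈ S ∧ z (Fin.last n) = f (Fin.init z) :=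
  Iff.rfl

/-- Unfolding lemma for `bandOver`. [cite: BasuPollackRoy2006, Def. 5.1] -/
theorem mem_bandOver_iff {S : Set (Fin n → ℝ)} {ξ : Fin l → (Fin n → ℝ) → ℝ} {j : Fin (l + 1)}
    {z : Fin (n + 1) → ℝ} :
    z ∈ bandOver S ξ j ↔ Fin.init z ∈ S ∧ bandLower ξ j (Fin.init z) < (z (Fin.last n) : EReal) ∧
      (z (Fin.last n) : EReal) < bandUpper ξ j (Fin.init z) :=
  Iff.rfl

/-- Vertical fibres of a graph: `(x, t)` lies on the graph of `f` over `S` iff `x ∈ S` and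
`t = f x`. [cite: BasuPollackRoy2006, Def. 5.1] -/
@[simp] theorem snoc_mem_graphOver_iff {S : Set (Fin n → ℝ)} {f : (Fin n → ℝ) → ℝ}
    {x : Fin n → ℝ} {t : ℝ} :
    (Fin.snoc x t : Fin (n + 1) → ℝ) ∈ graphOver S f ↔ x ∈ S ∧ t = f x := by
  simp [graphOver]

/-- Vertical fibres of a band: `(x, t)` lies in the `j`-th band over `S` iff `x ∈ S` and
`ξ_{j-1} x < t < ξ_j x` (extended-real conventions at `j = 0, ℓ`). [cite: BasuPollackRoy2006, Def. 5.1] -/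
@[simp] theorem snoc_mem_bandOver_iff {S : Set (Fin n → ℝ)} {ξ : Fin l → (Fin n → ℝ) → ℝ}
    {j : Fin (l + 1)} {x : Fin n → ℝ} {t : ℝ} :
    (Fin.snoc x t : Fin (n + 1) → ℝ) ∈ bandOver S ξ j ↔
      x ∈ S ∧ bandLower ξ j x < t ∧ (t : EReal) < bandUpper ξ j x := by
  simp [bandOver]

/-- Vertical fibres of a band with two finite boundaries (`0 < j < ℓ`): the open interval
`(ξ_{j-1} x, ξ_j x)`. [cite: BasuPollackRoy2006, Def. 5.1] -/
theorem snoc_mem_bandOver_iff_of_ne {S : Set (Fin n → ℝ)} {ξ : Fin l → (Fin n → ℝ) → ℝ}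
    {j : Fin (l + 1)} (h0 : j ≠ 0) (hl : j ≠ Fin.last l) {x : Fin n → ℝ} {t : ℝ} :
    (Fin.snoc x t : Fin (n + 1) → ℝ) ∈ bandOver S ξ j ↔
      x ∈ S ∧ t ∈ Ioo (ξ (j.pred h0) x) (ξ (j.castPred hl) x) := by
  rw [snoc_mem_bandOver_iff, bandLower_of_ne_zero ξ j h0, bandUpper_of_ne_last ξ j hl,
    EReal.coe_lt_coe_iff, EReal.coe_lt_coe_iff, mem_Ioo]

/-- A function is `k`-semialgebraic on `S` (`IsSemialgebraicFunOn`, graph via `Fin.snoc`) iff its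
graph over `S` in the present coordinates is a `k`-semialgebraic set. [cite: BochnakCosteRoy1998, Def. 2.2.5] -/
theorem isSemialgebraicFunOn_iff_isSemialgebraic_graphOver {k : Type*} [CommRing k] [Algebra k ℝ]
    {S : Set (Fin n → ℝ)} {f : (Fin n → ℝ) → ℝ} :
    IsSemialgebraicFunOn k S f ↔ IsSemialgebraic k (graphOver S f) :=
  isSemialgebraicFunOn_iff

end Cells

/-! ### Cylindrical decompositions (Def. 5.1) and the existence theorem (Thm. 5.6 / Cor. 5.7) -/

section Decomposition

variable (k : Type*) [CommRing k] [Algebra k ℝ]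

/-- **The inductive clause of a cylindrical decomposition** [BasuPollackRoy2006, Def. 5.1, second
bullet]: the finite family `𝒯` of subsets of `ℝⁿ⁺¹` is the *stack* over the finite family `𝒮` of
subsets of `ℝⁿ` — for every `S ∈ 𝒮` there are finitely many functions
`ξ_{S,0} < ξ_{S,1} < ⋯ < ξ_{S,ℓ_S-1} : ℝⁿ → ℝ` (strictly increasing pointwise on `S`), continuous on
`S` and `k`-semialgebraic on `S`, such that `𝒯` consists exactly of the graphs `graphOver S ξ_{S,j}`
and the bands `bandOver S ξ_S j` (`j = 0, …, ℓ_S`, including `(-∞, ξ_{S,0})` and `(ξ_{S,ℓ_S-1}, +∞)`)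
over the members `S ∈ 𝒮`. When `𝒮` partitions `ℝⁿ` this says precisely that each cylinder `S × ℝ`
is the disjoint union of the cells of `𝒯` that are these graphs and bands (BPR's wording).
The data `ℓ, ξ` are total functions on `Set ℝⁿ`; only their values at members of `𝒮` matter.
[cite: BasuPollackRoy2006, Def. 5.1] -/
def IsCylinderStack (𝒮 : Finset (Set (Fin n → ℝ))) (𝒯 : Finset (Set (Fin (n + 1) → ℝ))) : Prop :=
  ∃ (l : Set (Fin n → ℝ) → ℕ) (ξ : (S : Set (Fin n → ℝ)) → Fin (l S) → (Fin n → ℝ) → ℝ),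
    (∀ S ∈ 𝒮, ∀ j, ContinuousOn (ξ S j) S) ∧
    (∀ S ∈ 𝒮, ∀ j, IsSemialgebraicFunOn k S (ξ S j)) ∧
    (∀ S ∈ 𝒮, ∀ x ∈ S, StrictMono fun j => ξ S j x) ∧
    ∀ T, T ∈ 𝒯 ↔ ∃ S ∈ 𝒮, (∃ j, T = graphOver S (ξ S j)) ∨ ∃ j, T = bandOver S (ξ S) j

/-- **Cylindrical decomposition of `ℝⁿ` with `k`-semialgebraic cells** [BasuPollackRoy2006,
Def. 5.1], as a predicate on the top-level family of cells, by recursion on the level `n`: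
* level `0`: the one-point space `ℝ⁰` is decomposed into its single cell `univ`
  (convention `(0,1)⁰ = point`, [BasuPollackRoy2006, Prop. 5.3]; [Dries1998, Ch. 3 (2.6)]);
* level `n + 1`: `𝒯` is a finite partition of `ℝⁿ⁺¹` (`Setoid.IsPartition`: nonempty, pairwise
  disjoint, covering) into `k`-semialgebraic sets, and it is the stack (`IsCylinderStack`) of graphs
  and bands of continuous `k`-semialgebraic sections over the cells of some cylindrical decomposition
  `𝒮` of `ℝⁿ` (the sequence `𝒮₁, …, 𝒮ₙ` of BPR is recovered by unwinding the recursion; cf.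
  [Dries1998, Ch. 3 (2.10)]).
So the cells of level `1` are points and open intervals (graphs and bands over the point `ℝ⁰`), as in
the first bullet of Def. 5.1. [cite: BasuPollackRoy2006, Def. 5.1] -/
def IsCylindricalDecomposition : (n : ℕ) → Finset (Set (Fin n → ℝ)) → Prop
  | 0, 𝒮 => 𝒮 = {univ}
  | n + 1, 𝒯 => Setoid.IsPartition (𝒯 : Set (Set (Fin (n + 1) → ℝ))) ∧
      (∀ T ∈ 𝒯, IsSemialgebraic k T) ∧
      ∃ 𝒮 : Finset (Set (Fin n → ℝ)), IsCylindricalDecomposition n 𝒮 ∧ IsCylinderStack k 𝒮 𝒯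

/-- **Cylindrical decomposition adapted to a finite family of semialgebraic sets**
[BasuPollackRoy2006, Thm. 5.6 (Cylindrical decomposition) and Cor. 5.7, with Def. 5.1]: *for every
finite family `S₁, …, S_ℓ` of semi-algebraic subsets of `Rᵏ` there is a cylindrical decomposition of
`Rᵏ` adapted to `S₁, …, S_ℓ`, i.e. such that every `Sᵢ` is a union of cells.* Vendored over the
ambient field `ℝ` and for sets semialgebraic with coefficients in `k` (= *defined over* the subring
`D = Set.range (algebraMap k ℝ)`, [BasuPollackRoy2006, §2.3]): the decomposition then has `k`-semialgebraic
cells and `k`-semialgebraic continuous sections, because BPR's proof is uniform in the ordered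
coefficient domain `D ⊂ R` — the cells are the realizations of sign conditions on the cylindrifying
family of `𝒫 ⊂ D[X₁, …, X_k]` (Thm. 5.34), which stays in `D[X]` under `∂/∂Xᵢ` and `Elim_{Xᵢ}`
(Not. 5.15; Algorithms 11.1–11.2, "Structure: an ordered integral domain `D` contained in a real
closed field `R`"), and the sections are continuous with graphs among the cells (Thm. 5.16, Def. 5.1).
Named fact, not proved in the tree (the proof rests on continuity of roots, Thm. 5.12–5.16).
[cite: BasuPollackRoy2006, Cor. 5.7] -/
def IsSemialgebraic.exists_cylindricalDecomposition : Prop :=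
  ∀ {n : ℕ} (F : Finset (Set (Fin n → ℝ))), (∀ s ∈ F, IsSemialgebraic k s) →
    ∃ 𝒮 : Finset (Set (Fin n → ℝ)), IsCylindricalDecomposition k n 𝒮 ∧
      ∀ s ∈ F, ∃ 𝒞 ⊆ 𝒮, ⋃₀ (𝒞 : Set (Set (Fin n → ℝ))) = s

variable {k}

/-- Unfolding the recursion at level `0`: the only decomposition of the point `ℝ⁰` is `{univ}`.
[cite: BasuPollackRoy2006, Def. 5.1] -/
theorem isCylindricalDecomposition_zero {𝒮 : Finset (Set (Fin 0 → ℝ))} :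
    IsCylindricalDecomposition k 0 𝒮 ↔ 𝒮 = {univ} :=
  Iff.rfl

/-- Unfolding the recursion at level `n + 1`. [cite: BasuPollackRoy2006, Def. 5.1] -/
theorem isCylindricalDecomposition_succ {𝒯 : Finset (Set (Fin (n + 1) → ℝ))} :
    IsCylindricalDecomposition k (n + 1) 𝒯 ↔
      Setoid.IsPartition (𝒯 : Set (Set (Fin (n + 1) → ℝ))) ∧ (∀ T ∈ 𝒯, IsSemialgebraic k T) ∧
        ∃ 𝒮 : Finset (Set (Fin n → ℝ)), IsCylindricalDecomposition k n 𝒮 ∧ IsCylinderStack k 𝒮 𝒯 :=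
  Iff.rfl

/-- The cells of (every level of) a cylindrical decomposition form a partition of the ambient
space. [cite: BasuPollackRoy2006, Def. 5.1] -/
theorem IsCylindricalDecomposition.isPartition {𝒮 : Finset (Set (Fin n → ℝ))}
    (h : IsCylindricalDecomposition k n 𝒮) : Setoid.IsPartition (𝒮 : Set (Set (Fin n → ℝ))) := by
  cases n with
  | zero =>
    have h' : 𝒮 = {univ} := h
    subst h'
    rw [Finset.coe_singleton]
    refine ⟨fun h0 => empty_ne_univ (mem_singleton_iff.1 h0), fun a => ?_⟩
    exact ⟨univ, ⟨mem_singleton _, mem_univ a⟩, fun b hb => mem_singleton_iff.1 hb.1⟩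
  | succ n => exact h.1

/-- The cells of a cylindrical decomposition are `k`-semialgebraic. [cite: BasuPollackRoy2006, Def. 5.1] -/
theorem IsCylindricalDecomposition.isSemialgebraic {𝒮 : Finset (Set (Fin n → ℝ))}
    (h : IsCylindricalDecomposition k n 𝒮) : ∀ S ∈ 𝒮, IsSemialgebraic k S := by
  cases n with
  | zero =>
    have h' : 𝒮 = {univ} := h
    subst h'
    intro S hS
    rw [Finset.mem_singleton] at hS
    subst hS
    exact isSemialgebraic_univ
  | succ n => exact h.2.1

/-- A cylindrical decomposition of `ℝⁿ⁺¹` is the stack over a cylindrical decomposition of `ℝⁿ`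
(its family of projections, [BasuPollackRoy2006, Rem. 5.2]). [cite: BasuPollackRoy2006, Def. 5.1] -/
theorem IsCylindricalDecomposition.exists_isCylinderStack {𝒯 : Finset (Set (Fin (n + 1) → ℝ))}
    (h : IsCylindricalDecomposition k (n + 1) 𝒯) :
    ∃ 𝒮 : Finset (Set (Fin n → ℝ)), IsCylindricalDecomposition k n 𝒮 ∧ IsCylinderStack k 𝒮 𝒯 :=
  h.2.2

/-- **Fibre structure of one semialgebraic set over the cells of an adapted cylindrical
decomposition** (the form consumed by the Stokes reduction of the Kontsevich–Zagier calculus).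
Assuming the named fact `IsSemialgebraic.exists_cylindricalDecomposition k`: for a `k`-semialgebraic
`σ ⊆ ℝⁿ⁺¹` there are a cylindrical decomposition `𝒮` of `ℝⁿ` (so `𝒮` partitions `ℝⁿ` into
`k`-semialgebraic cells) and over each `S ∈ 𝒮` sections `ξ_{S,0} < ⋯ < ξ_{S,ℓ_S-1}`, continuous and
`k`-semialgebraic on `S`, together with FIXED index sets `G ⊆ Fin ℓ_S`, `B ⊆ Fin (ℓ_S + 1)` (the
graphs and bands over `S` contained in `σ`; all graphs and bands are `k`-semialgebraic) such that
for every `x ∈ S` the vertical fibre `{t | (x, t) ∈ σ}` is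
`⋃_{j ∈ G} {ξ_{S,j} x} ∪ ⋃_{j ∈ B} (ξ_{S,j-1} x, ξ_{S,j} x)`. Proof: take the
decomposition of `ℝⁿ⁺¹` adapted to `{σ}`; a cell meeting the fibre over `x ∈ S` lies above the
unique base cell containing `x`, namely `S`. [cite: BasuPollackRoy2006, Cor. 5.7] -/
theorem IsSemialgebraic.exists_cylindricalDecomposition.exists_fibre_eq
    (h : IsSemialgebraic.exists_cylindricalDecomposition k) {n : ℕ} {σ : Set (Fin (n + 1) → ℝ)}
    (hσ : IsSemialgebraic k σ) :
    ∃ (𝒮 : Finset (Set (Fin n → ℝ))) (l : Set (Fin n → ℝ) → ℕ)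
      (ξ : (S : Set (Fin n → ℝ)) → Fin (l S) → (Fin n → ℝ) → ℝ),
      IsCylindricalDecomposition k n 𝒮 ∧
      (∀ S ∈ 𝒮, ∀ j, ContinuousOn (ξ S j) S) ∧
      (∀ S ∈ 𝒮, ∀ j, IsSemialgebraicFunOn k S (ξ S j)) ∧
      (∀ S ∈ 𝒮, ∀ x ∈ S, StrictMono fun j => ξ S j x) ∧
      (∀ S ∈ 𝒮, (∀ j, IsSemialgebraic k (graphOver S (ξ S j))) ∧
        ∀ j, IsSemialgebraic k (bandOver S (ξ S) j)) ∧
      ∀ S ∈ 𝒮, ∃ (G : Finset (Fin (l S))) (B : Finset (Fin (l S + 1))),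
        (∀ j ∈ G, graphOver S (ξ S j) ⊆ σ) ∧ (∀ j ∈ B, bandOver S (ξ S) j ⊆ σ) ∧
        ∀ x ∈ S, {t : ℝ | (Fin.snoc x t : Fin (n + 1) → ℝ) ∈ σ} =
          (⋃ j ∈ G, {ξ S j x}) ∪
            ⋃ j ∈ B, {t : ℝ | bandLower (ξ S) j x < t ∧ (t : EReal) < bandUpper (ξ S) j x} := by
  classical
  obtain ⟨𝒯, h𝒯, had⟩ := h ({σ} : Finset (Set (Fin (n + 1) → ℝ)))
    (fun s hs => by rw [Finset.mem_singleton] at hs; subst hs; exact hσ)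
  obtain ⟨𝒞, h𝒞𝒯, hσU⟩ := had σ (Finset.mem_singleton_self σ)
  obtain ⟨-, h𝒯sa, 𝒮, h𝒮, l, ξ, hcont, hsa, hmono, hmem⟩ := h𝒯
  have h𝒮part := h𝒮.isPartition
  refine ⟨𝒮, l, ξ, h𝒮, hcont, hsa, hmono, fun S hS => ⟨fun j => ?_, fun j => ?_⟩, fun S hS => ?_⟩
  · exact h𝒯sa _ ((hmem _).2 ⟨S, hS, Or.inl ⟨j, rfl⟩⟩)
  · exact h𝒯sa _ ((hmem _).2 ⟨S, hS, Or.inr ⟨j, rfl⟩⟩)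
  refine ⟨Finset.univ.filter fun j => graphOver S (ξ S j) ∈ 𝒞,
    Finset.univ.filter fun j => bandOver S (ξ S) j ∈ 𝒞, ?_, ?_, fun x hx => ?_⟩
  · intro j hj
    rw [Finset.mem_filter] at hj
    rw [← hσU]
    exact subset_sUnion_of_mem hj.2
  · intro j hj
    rw [Finset.mem_filter] at hj
    rw [← hσU]
    exact subset_sUnion_of_mem hj.2
  · ext t
    simp only [mem_setOf_eq, mem_union, mem_iUnion, Finset.mem_filter, Finset.mem_univ, true_and,
      mem_singleton_iff, exists_prop]
    constructor
    · intro ht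
      rw [← hσU] at ht
      obtain ⟨T, hT𝒞, hzT⟩ := mem_sUnion.1 ht
      obtain ⟨S', hS', hT⟩ := (hmem T).1 (h𝒞𝒯 hT𝒞)
      have hxS' : x ∈ S' := by
        rcases hT with ⟨j, rfl⟩ | ⟨j, rfl⟩
        · exact (snoc_mem_graphOver_iff.1 hzT).1
        · exact (snoc_mem_bandOver_iff.1 hzT).1
      obtain rfl : S' = S := by
        obtain ⟨U, -, huniq⟩ := h𝒮part.2 x
        exact (huniq S' ⟨hS', hxS'⟩).trans (huniq S ⟨hS, hx⟩).symm
      rcases hT with ⟨j, rfl⟩ | ⟨j, rfl⟩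
      · exact Or.inl ⟨j, hT𝒞, (snoc_mem_graphOver_iff.1 hzT).2⟩
      · exact Or.inr ⟨j, hT𝒞, (snoc_mem_bandOver_iff.1 hzT).2⟩
    · rintro (⟨j, hj, rfl⟩ | ⟨j, hj, ht⟩)
      · rw [← hσU]
        exact mem_sUnion.2 ⟨_, hj, snoc_mem_graphOver_iff.2 ⟨hx, rfl⟩⟩
      · rw [← hσU]
        exact mem_sUnion.2 ⟨_, hj, snoc_mem_bandOver_iff.2 ⟨hx, ht⟩⟩

end Decomposition

end Literature.ModelTheory.ExponentialFields
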